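import Summits.HodgeConjecture.CorCM.IrreducibleOddWeightsShadowIdealsHecke
import HarnessLib

/-!
# Shadow ideals, IV: a COMMUTATIVE torsor — the Hecke modules of the two shadows meet in `0` iff they are ORTHOGONAL,
# i.e. iff the shadows are uncorrelated in every relative position, `Σ_y w₀(y)·w₁(q_σ y) = 0` for all `σ`

COR-CM (cell `pub-hodgecm2`, binder seat `b16` gen 63, count-neutral claim SHADOW IDEALS, file S4 — abstract level;
theorems only, no definition, no named fact, no `sorry`).  NEW as stated, hence under `Summits/`.  HONEST FRAMING:
finite-dimensional linear algebra about the Kubota–Dodson rank of a pair of CM types (`Hg(A₀ × A₁)` versus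
`Hg(A₀) × Hg(A₁)`); `HC_CM` is neither used nor asserted.

SETTING of file S3 (`IrreducibleOddWeightsShadowIdealsHecke`): shadows `w₀, w₁ ∈ ℚ^Y` of the two types on a pivot `Y`
and a family `q_σ : Y → Y`; S3 proved: additive iff `span{w₀ ∘ q_σ} ∩ span{w₁ ∘ q_σ} = 0`.  Here `Γ` is a GROUP acting on
`Y` through the `q_σ` ON THE RIGHT (`q_1 = id`, `q_{στ} = q_τ ∘ q_σ` — pre-composition `z ↦ z ∘ δ` on `Hom(M, ℂ)`),
TRANSITIVELY, and `Γ` is COMMUTATIVE (`M` an ABELIAN Galois field).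

* §1 `dotProduct_eq_zero_of_mem_span_of_mem_span`, `span_inf_span_eq_bot_of_forall_dotProduct_eq_zero`: spans of
  mutually orthogonal sets meet in `0` (the dot product on `ℚ^Y` is positive definite).
* §2 **`span_precomp_inf_eq_bot_of_forall_sum_mul_eq_zero`** (any group `Γ`): if `Σ_y w₀(y) w₁(q_σ y) = 0` for every
  `σ`, the two Hecke modules are orthogonal (`⟨w₀ ∘ q_σ, w₁ ∘ q_τ⟩ = ⟨w₀, w₁ ∘ q_{σ⁻¹τ}⟩`), hence meet in `0`.
  **`sum_mul_precomp_eq_zero_of_span_precomp_inf_eq_bot`** (`Γ` COMMUTATIVE and transitive): conversely, if the Hecke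
  modules `I₀ = span{w₀ ∘ q_σ}`, `I₁` meet in `0` they are ORTHOGONAL.  PROOF: `I_κ` and `I_κ^⊥` are stable under every
  `q_τ^*` (isometries), so the orthogonal projection `p_κ` onto `I_κ` commutes with all `q_τ^*`; by S3's
  `exists_sum_precomp_of_commute` (the `q_σ` commute with THEMSELVES) `p₀ = Σ_y c_y q_{τ_y}^*` lies in the commutative Hecke
  algebra, so `p₀ p₁ = p₁ p₀` maps into `I₀ ∩ I₁ = 0`; `p₀` is self-adjoint, whence `⟨a, b⟩ = ⟨p₀ a, p₁ b⟩ =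
  ⟨a, p₀ p₁ b⟩ = 0` for `a ∈ I₀`, `b ∈ I₁`.  (In `ℚ[Γ]`: ideals of a commutative semisimple algebra with positive
  involution meet in `0` iff they are orthogonal — multiplicity one of the regular representation over `ℚ`.)
  **`span_precomp_inf_eq_bot_iff_forall_sum_mul_eq_zero`**: the iff.
* §3 **`typeRank_sigmaType_add_card_eq_iff_forall_sum_mul_precomp_eq_zero`** — THE CORRELATION CRITERION: under S1's
  (H1)–(H3), `G` transitive on `Y`, `q` a transitive commutative right action commuting with `G`:
  `rank(Φ₀, Φ₁) + 2 = rank Φ₀ + rank Φ₁ + 1` (`Hg(A₀ × A₁) = Hg(A₀) × Hg(A₁)`) **iff `Σ_y w₀(y)·w₁(q_σ y) = 0` for every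
  `σ ∈ Γ`** — a finite list of integer equalities; unconditional half
  `typeRank_sigmaType_add_card_lt_of_sum_mul_precomp_ne_zero` (one non-zero correlation obstructs, any group `Γ`).  In
  characters: iff no odd character `χ` of `Γ` has `χ(w₀) ≠ 0 ≠ χ(w₁)` — Kubota's Lemma 2 for a PAIR of different fields
  over a common abelian subfield (file S5 `…CMFields`).

## References

* [Kubota1965] T. Kubota, *On the field extension by complex multiplication*, Trans. AMS 118 (1965), §2 Lemma 2.
* [Gordon1999HodgeAVSurvey] B. B. Gordon, *A survey of the Hodge conjecture for abelian varieties*, §3 Theorem (proof),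
  7.5–7.7, 9.4.1.
* [Serre1977] J.-P. Serre, *Linear Representations of Finite Groups*, GTM 42, §2.2 Prop. 4, §3.3, §13.2.
* [Shimura1998] G. Shimura, *Abelian Varieties with Complex Multiplication and Modular Functions*, §8.1.
-/

set_option autoImplicit false

noncomputable section

open scoped BigOperators

universe u v v' w

namespace Summit.HodgeConjecture.CorCM.IrrOdd

open Literature.NumberTheory.ComplexMultiplication

variable {G : Type w} [Group G]

/-! ### §1 Orthogonal spans meet in `0` -/

section Orthogonal

variable {Y : Type v'} [Fintype Y]

/-- Elements of the spans of two mutually orthogonal sets of vectors are orthogonal. [folklore] -/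
theorem dotProduct_eq_zero_of_mem_span_of_mem_span {S T : Set (Y → ℚ)} (h : ∀ s ∈ S, ∀ t ∈ T, s ⬝ᵥ t = 0)
    {a b : Y → ℚ} (ha : a ∈ Submodule.span ℚ S) (hb : b ∈ Submodule.span ℚ T) : a ⬝ᵥ b = 0 := by
  have h1 : ∀ s ∈ S, ∀ b ∈ Submodule.span ℚ T, s ⬝ᵥ b = 0 := by
    intro s hs b hb
    induction hb using Submodule.span_induction with
    | mem t ht => exact h s hs t ht
    | zero => exact dotProduct_zero s
    | add t t' _ _ ht ht' => rw [dotProduct_add, ht, ht', add_zero]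
    | smul c t _ ht => rw [dotProduct_smul, ht, smul_zero]
  induction ha using Submodule.span_induction with
  | mem s hs => exact h1 s hs b hb
  | zero => exact zero_dotProduct b
  | add s s' _ _ hs hs' => rw [add_dotProduct, hs, hs', add_zero]
  | smul c s _ hs => rw [smul_dotProduct, hs, smul_zero]

/-- **Spans of mutually orthogonal sets meet in `0`** (the dot product on `ℚ^Y` is positive definite). [folklore] -/
theorem span_inf_span_eq_bot_of_forall_dotProduct_eq_zero {S T : Set (Y → ℚ)}
    (h : ∀ s ∈ S, ∀ t ∈ T, s ⬝ᵥ t = 0) : Submodule.span ℚ S ⊓ Submodule.span ℚ T = ⊥ :=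
  eq_bot_iff.2 fun _ hx => (Submodule.mem_bot ℚ).2
    (dotProduct_self_eq_zero.1 (dotProduct_eq_zero_of_mem_span_of_mem_span h hx.1 hx.2))

end Orthogonal

/-! ### §2 Commutative torsors: trivial intersection ⟺ orthogonality -/

section Commutative

variable {Y : Type v'} [Fintype Y] [DecidableEq Y] {Γ : Type*} [Group Γ]

omit [DecidableEq Y] in
/-- **UNCORRELATED SHADOWS HAVE HECKE MODULES MEETING IN `0`** (any group `Γ` acting on the right through the `q_σ`):
if `Σ_y w₀(y)·w₁(q_σ y) = 0` for every `σ`, then `span{w₀ ∘ q_σ} ∩ span{w₁ ∘ q_σ} = 0` (the generators are pairwise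
orthogonal: `⟨w₀ ∘ q_σ, w₁ ∘ q_τ⟩ = ⟨w₀, w₁ ∘ q_{σ⁻¹τ}⟩`). [cite: Serre1977, §3.3] -/
theorem span_precomp_inf_eq_bot_of_forall_sum_mul_eq_zero (q : Γ → Y → Y) (hone : ∀ y, q 1 y = y)
    (hmul : ∀ (σ τ : Γ) (y : Y), q (σ * τ) y = q τ (q σ y)) (w₀ w₁ : Y → ℚ)
    (horth : ∀ σ : Γ, ∑ y, w₀ y * w₁ (q σ y) = 0) :
    Submodule.span ℚ (Set.range fun σ : Γ => fun y => w₀ (q σ y)) ⊓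
      Submodule.span ℚ (Set.range fun σ : Γ => fun y => w₁ (q σ y)) = ⊥ := by
  have hli : ∀ (τ : Γ) (y : Y), q τ⁻¹ (q τ y) = y := fun τ y => by rw [← hmul, mul_inv_cancel, hone]
  have hri : ∀ (τ : Γ) (y : Y), q τ (q τ⁻¹ y) = y := fun τ y => by rw [← hmul, inv_mul_cancel, hone]
  refine span_inf_span_eq_bot_of_forall_dotProduct_eq_zero ?_
  rintro _ ⟨σ, rfl⟩ _ ⟨τ, rfl⟩
  change (∑ y, w₀ (q σ y) * w₁ (q τ y)) = 0
  rw [← horth (σ⁻¹ * τ)]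
  exact Fintype.sum_bijective (q σ) (Function.bijective_iff_has_inverse.2 ⟨q σ⁻¹, hli σ, hri σ⟩) _ _ fun y => by
    simp only [hmul, hli]

/-- **HECKE MODULES MEETING IN `0` ARE ORTHOGONAL, for a COMMUTATIVE group acting transitively on the right.**  If
`span{w₀ ∘ q_σ} ∩ span{w₁ ∘ q_σ} = 0` then `Σ_y w₀(y)·w₁(q_σ y) = 0` for every `σ`.  (The orthogonal projections onto the
two Hecke modules lie in the commutative Hecke algebra — `exists_sum_precomp_of_commute` — so their product is the
projection onto the intersection.) [cite: Serre1977, §3.3 and §13.2] [cite: Kubota1965, §2 Lemma 2] -/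
theorem sum_mul_precomp_eq_zero_of_span_precomp_inf_eq_bot (q : Γ → Y → Y) (hone : ∀ y, q 1 y = y)
    (hmul : ∀ (σ τ : Γ) (y : Y), q (σ * τ) y = q τ (q σ y)) (hcomm : ∀ σ τ : Γ, σ * τ = τ * σ) (y₀ : Y)
    (hcov : ∀ y, ∃ σ, q σ y = y₀) (w₀ w₁ : Y → ℚ)
    (hbot : Submodule.span ℚ (Set.range fun σ : Γ => fun y => w₀ (q σ y)) ⊓
      Submodule.span ℚ (Set.range fun σ : Γ => fun y => w₁ (q σ y)) = ⊥) (σ : Γ) :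
    ∑ y, w₀ y * w₁ (q σ y) = 0 := by
  -- inverses, bijectivity, commutation
  have hli : ∀ (τ : Γ) (y : Y), q τ⁻¹ (q τ y) = y := fun τ y => by rw [← hmul, mul_inv_cancel, hone]
  have hri : ∀ (τ : Γ) (y : Y), q τ (q τ⁻¹ y) = y := fun τ y => by rw [← hmul, inv_mul_cancel, hone]
  have hbij : ∀ τ, Function.Bijective (q τ) := fun τ =>
    Function.bijective_iff_has_inverse.2 ⟨q τ⁻¹, hli τ, hri τ⟩
  have hqq : ∀ (l τ : Γ) (y : Y), q τ (q l y) = q l (q τ y) := fun l τ y => by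
    rw [← hmul, hcomm, hmul]
  let B : LinearMap.BilinForm ℚ (Y → ℚ) := dotProductBilin ℚ ℚ
  -- Hecke modules are stable under every pull-back …
  have hst : ∀ (w : Y → ℚ) (τ : Γ), ∀ a ∈ Submodule.span ℚ (Set.range fun σ : Γ => fun y => w (q σ y)),
      (fun y => a (q τ y)) ∈ Submodule.span ℚ (Set.range fun σ : Γ => fun y => w (q σ y)) := by
    intro w τ a ha
    have hle : (Submodule.span ℚ (Set.range fun σ : Γ => fun y => w (q σ y))).map
        (LinearMap.funLeft ℚ ℚ (q τ)) ≤ Submodule.span ℚ (Set.range fun σ : Γ => fun y => w (q σ y)) := by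
      rw [Submodule.map_span_le]
      rintro _ ⟨σ', rfl⟩
      refine Submodule.subset_span ⟨τ * σ', ?_⟩
      funext y
      simp only [LinearMap.funLeft_apply, hmul]
    exact hle ⟨a, ha, rfl⟩
  -- … and so are their orthogonal complements (the pull-backs are isometries)
  have hperp : ∀ W : Submodule ℚ (Y → ℚ), (∀ τ, ∀ a ∈ W, (fun y => a (q τ y)) ∈ W) →
      ∀ τ, ∀ b ∈ B.orthogonal W, (fun y => b (q τ y)) ∈ B.orthogonal W := by
    intro W hW τ b hb
    rw [LinearMap.BilinForm.mem_orthogonal_iff] at hb ⊢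
    intro n hn
    have h1 := hb _ (hW τ⁻¹ n hn)
    change _ ⬝ᵥ _ = 0 at h1
    change _ ⬝ᵥ _ = 0
    rw [← h1]
    exact Fintype.sum_bijective (q τ) (hbij τ) _ _ fun y => by simp only [hli]
  -- orthogonal projections commute with the pull-backs
  have hproj : ∀ (W : Submodule ℚ (Y → ℚ)) (hc : IsCompl W (B.orthogonal W)),
      (∀ τ, ∀ a ∈ W, (fun y => a (q τ y)) ∈ W) →
      ∀ (τ : Γ) (f : Y → ℚ), W.projection (B.orthogonal W) hc (fun y => f (q τ y)) =
        fun y => W.projection (B.orthogonal W) hc f (q τ y) := by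
    intro W hc hW τ f
    obtain ⟨a, ha, b, hb, rfl⟩ := Submodule.mem_sup.1 (hc.sup_eq_top.symm ▸ Submodule.mem_top (x := f))
    have hsplit : (fun y => (a + b) (q τ y)) = (fun y => a (q τ y)) + fun y => b (q τ y) := rfl
    rw [hsplit, map_add, map_add, Submodule.projection_apply_of_mem_left hc (hW τ a ha),
      Submodule.projection_apply_of_mem_right hc (hperp W hW τ b hb), Submodule.projection_apply_of_mem_left hc ha,
      Submodule.projection_apply_of_mem_right hc hb, add_zero, add_zero]
  -- the two modules and their projections
  set I₀ : Submodule ℚ (Y → ℚ) := Submodule.span ℚ (Set.range fun σ : Γ => fun y => w₀ (q σ y)) with hI₀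
  set I₁ : Submodule ℚ (Y → ℚ) := Submodule.span ℚ (Set.range fun σ : Γ => fun y => w₁ (q σ y)) with hI₁
  have hc₀ : IsCompl I₀ (B.orthogonal I₀) := isCompl_dotProduct_orthogonal I₀
  have hc₁ : IsCompl I₁ (B.orthogonal I₁) := isCompl_dotProduct_orthogonal I₁
  set p₀ : (Y → ℚ) →ₗ[ℚ] (Y → ℚ) := I₀.projection (B.orthogonal I₀) hc₀ with hp₀
  set p₁ : (Y → ℚ) →ₗ[ℚ] (Y → ℚ) := I₁.projection (B.orthogonal I₁) hc₁ with hp₁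
  -- `p₀` lies in the (commutative) Hecke algebra
  obtain ⟨c, τ, hp₀c⟩ := exists_sum_precomp_of_commute q q hqq (fun σ' => (hbij σ').1) (fun σ' => (hbij σ').1) y₀
    hcov hcov p₀ (hproj I₀ hc₀ (hst w₀))
  -- so it commutes with `p₁`, and `p₀ p₁` maps into `I₀ ∩ I₁ = 0`
  have hcomm01 : ∀ f, p₀ (p₁ f) = p₁ (p₀ f) := fun f => by
    rw [hp₀c (p₁ f), hp₀c f, map_sum]
    refine Finset.sum_congr rfl fun y _ => ?_
    rw [map_smul, hproj I₁ hc₁ (hst w₁)]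
  have hzero : ∀ f, p₀ (p₁ f) = 0 := fun f => by
    have hmem : p₀ (p₁ f) ∈ I₀ ⊓ I₁ :=
      ⟨Submodule.projection_apply_mem hc₀ _, hcomm01 f ▸ Submodule.projection_apply_mem hc₁ _⟩
    rw [hbot, Submodule.mem_bot] at hmem
    exact hmem
  -- `p₀` is self-adjoint
  have key : ∀ a b : Y → ℚ, p₀ a ⬝ᵥ b = p₀ a ⬝ᵥ p₀ b := fun a b => by
    have hb' : b - p₀ b ∈ B.orthogonal I₀ := by
      rw [← Submodule.projection_apply_eq_zero_iff hc₀, map_sub,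
        Submodule.projection_apply_of_mem_left hc₀ (Submodule.projection_apply_mem hc₀ b), sub_self]
    have h1 := (LinearMap.BilinForm.mem_orthogonal_iff.1 hb') (p₀ a) (Submodule.projection_apply_mem hc₀ a)
    change p₀ a ⬝ᵥ (b - p₀ b) = 0 at h1
    rwa [dotProduct_sub, sub_eq_zero] at h1
  have hsa : ∀ a b : Y → ℚ, p₀ a ⬝ᵥ b = a ⬝ᵥ p₀ b := fun a b => by
    rw [key a b, dotProduct_comm a (p₀ b), key b a, dotProduct_comm]
  -- conclusion
  have hw₀ : w₀ ∈ I₀ := Submodule.subset_span ⟨1, funext fun y => congrArg w₀ (hone y)⟩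
  have hw₁ : (fun y => w₁ (q σ y)) ∈ I₁ := Submodule.subset_span ⟨σ, rfl⟩
  calc ∑ y, w₀ y * w₁ (q σ y) = w₀ ⬝ᵥ fun y => w₁ (q σ y) := rfl
    _ = p₀ w₀ ⬝ᵥ p₁ (fun y => w₁ (q σ y)) := by
        rw [Submodule.projection_apply_of_mem_left hc₀ hw₀, Submodule.projection_apply_of_mem_left hc₁ hw₁]
    _ = w₀ ⬝ᵥ p₀ (p₁ fun y => w₁ (q σ y)) := hsa _ _
    _ = 0 := by rw [hzero, dotProduct_zero]

/-- **COMMUTATIVE TORSOR: the Hecke modules of `w₀`, `w₁` meet in `0` iff `Σ_y w₀(y)·w₁(q_σ y) = 0` for every `σ`.**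
[cite: Serre1977, §3.3 and §13.2] [cite: Kubota1965, §2 Lemma 2] -/
theorem span_precomp_inf_eq_bot_iff_forall_sum_mul_eq_zero (q : Γ → Y → Y) (hone : ∀ y, q 1 y = y)
    (hmul : ∀ (σ τ : Γ) (y : Y), q (σ * τ) y = q τ (q σ y)) (hcomm : ∀ σ τ : Γ, σ * τ = τ * σ) (y₀ : Y)
    (hcov : ∀ y, ∃ σ, q σ y = y₀) (w₀ w₁ : Y → ℚ) :
    Submodule.span ℚ (Set.range fun σ : Γ => fun y => w₀ (q σ y)) ⊓
        Submodule.span ℚ (Set.range fun σ : Γ => fun y => w₁ (q σ y)) = ⊥ ↔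
      ∀ σ : Γ, ∑ y, w₀ y * w₁ (q σ y) = 0 :=
  ⟨fun hbot σ => sum_mul_precomp_eq_zero_of_span_precomp_inf_eq_bot q hone hmul hcomm y₀ hcov w₀ w₁ hbot σ,
    fun horth => span_precomp_inf_eq_bot_of_forall_sum_mul_eq_zero q hone hmul w₀ w₁ horth⟩

end Commutative

/-! ### §3 The correlation criterion -/

section Criterion

variable {I : Type u} {E : I → Type v} [∀ i, MulAction G (E i)] [DecidableEq I] [Fintype I] [∀ i, Fintype (E i)]
  [Nonempty I] [∀ i, Nonempty (E i)] {Y : Type v'} [MulAction G Y] [Fintype Y] [DecidableEq Y] {Γ : Type*} [Group Γ]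

/-- **ONE NON-ZERO CORRELATION OF THE SHADOWS OBSTRUCTS ADDITIVITY** (commutative `Γ` acting transitively on the right
through maps `q_σ` commuting with `G`; no hypothesis on the fibres of `r_κ`): if `Σ_y w₀(y)·w₁(q_σ y) ≠ 0` for some
`σ`, then `rank(Σ) + |I| < Σ_i rank(Φ_i) + 1` (`dim MT(A₀ × A₁) − 1 < Σ_κ (dim MT(A_κ) − 1)`).
[cite: Gordon1999HodgeAVSurvey, §3 Theorem (proof) and 7.5] [cite: Kubota1965, §2 Lemma 2] -/
theorem typeRank_sigmaType_add_card_lt_of_sum_mul_precomp_ne_zero {ρ : G} {Φ : ∀ i, Set (E i)}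
    (h : ∀ i, IsCMTypeWith ρ (Φ i)) {i₀ i₁ : I} (h01 : i₀ ≠ i₁) (r₀ : E i₀ → Y) (r₁ : E i₁ → Y)
    (hr₀ : ∀ (g : G) (x : E i₀), r₀ (g • x) = g • r₀ x) (hr₁ : ∀ (g : G) (x : E i₁), r₁ (g • x) = g • r₁ x)
    (q : Γ → Y → Y) (hq : ∀ (σ : Γ) (g : G) (y : Y), q σ (g • y) = g • q σ y) (hone : ∀ y, q 1 y = y)
    (hmul : ∀ (σ τ : Γ) (y : Y), q (σ * τ) y = q τ (q σ y)) (hcomm : ∀ σ τ : Γ, σ * τ = τ * σ) (y₀ : Y)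
    (hcov : ∀ y, ∃ σ, q σ y = y₀) {σ : Γ}
    (hσ : ∑ y, (∑ x ∈ Finset.univ.filter (fun x => r₀ x = y), antiVec (Φ i₀) (1 : G) x) *
      (∑ x ∈ Finset.univ.filter (fun x => r₁ x = q σ y), antiVec (Φ i₁) (1 : G) x) ≠ 0) :
    typeRank G (sigmaType Φ) + Fintype.card I < (∑ i, typeRank G (Φ i)) + 1 :=
  typeRank_sigmaType_add_card_lt_of_span_precomp_inf_ne_bot h h01 r₀ r₁ hr₀ hr₁ q hq fun hbot =>
    hσ (sum_mul_precomp_eq_zero_of_span_precomp_inf_eq_bot q hone hmul hcomm y₀ hcov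
      (fun y => ∑ x ∈ Finset.univ.filter (fun x => r₀ x = y), antiVec (Φ i₀) (1 : G) x)
      (fun y => ∑ x ∈ Finset.univ.filter (fun x => r₁ x = y), antiVec (Φ i₁) (1 : G) x) hbot σ)

/-- **THE CORRELATION CRITERION.**  Two-slot family of CM types; pivot `Y` with equivariant surjections `r_κ` and a
fibre-transitive `N ⊆ ⟨pointwise stabilisers⟩` (S1 (H1)–(H3)); `G` transitive on `Y`; a COMMUTATIVE group `Γ` acting
transitively on `Y` on the right through maps `q_σ` commuting with `G`.  Then `rank(Φ₀, Φ₁) + 2 = rank Φ₀ + rank Φ₁ + 1`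
(`Hg(A₀ × A₁) = Hg(A₀) × Hg(A₁)`) **iff the shadows are uncorrelated in every relative position:
`Σ_y w₀(y)·w₁(q_σ y) = 0` for every `σ ∈ Γ`.** [cite: Kubota1965, §2 Lemma 2]
[cite: Gordon1999HodgeAVSurvey, §3 Theorem and 7.5–7.7, 9.4.1] [cite: Serre1977, §3.3 and §13.2] -/
theorem typeRank_sigmaType_add_card_eq_iff_forall_sum_mul_precomp_eq_zero {ρ : G} {Φ : ∀ i, Set (E i)}
    (h : ∀ i, IsCMTypeWith ρ (Φ i)) {i₀ i₁ : I} (hI : ∀ j, j = i₀ ∨ j = i₁) (h01 : i₀ ≠ i₁)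
    (r₀ : E i₀ → Y) (r₁ : E i₁ → Y)
    (hr₀ : ∀ (g : G) (x : E i₀), r₀ (g • x) = g • r₀ x) (hr₁ : ∀ (g : G) (x : E i₁), r₁ (g • x) = g • r₁ x)
    (hs₀ : Function.Surjective r₀) (hs₁ : Function.Surjective r₁) (N : Set G)
    (hN₀ : ∀ x x' : E i₀, r₀ x = r₀ x' → ∃ n ∈ N, n • x = x')
    (hN₁ : ∀ x x' : E i₁, r₁ x = r₁ x' → ∃ n ∈ N, n • x = x')
    (hNcl : N ⊆ Subgroup.closure ({g : G | ∀ x : E i₀, g • x = x} ∪ {g : G | ∀ x : E i₁, g • x = x}))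
    (q : Γ → Y → Y) (hq : ∀ (σ : Γ) (g : G) (y : Y), q σ (g • y) = g • q σ y) (hone : ∀ y, q 1 y = y)
    (hmul : ∀ (σ τ : Γ) (y : Y), q (σ * τ) y = q τ (q σ y)) (hcomm : ∀ σ τ : Γ, σ * τ = τ * σ) (y₀ : Y)
    (hcov : ∀ y, ∃ σ, q σ y = y₀) (htrans : ∀ y : Y, ∃ g : G, g • y = y₀) :
    typeRank G (sigmaType Φ) + Fintype.card I = (∑ i, typeRank G (Φ i)) + 1 ↔
      ∀ σ : Γ, ∑ y, (∑ x ∈ Finset.univ.filter (fun x => r₀ x = y), antiVec (Φ i₀) (1 : G) x) *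
        (∑ x ∈ Finset.univ.filter (fun x => r₁ x = q σ y), antiVec (Φ i₁) (1 : G) x) = 0 := by
  have hli : ∀ (τ : Γ) (y : Y), q τ⁻¹ (q τ y) = y := fun τ y => by rw [← hmul, mul_inv_cancel, hone]
  have hqinj : ∀ τ, Function.Injective (q τ) := fun τ => Function.LeftInverse.injective (hli τ)
  rw [typeRank_sigmaType_add_card_eq_iff_span_precomp_inf_eq_bot h hI h01 r₀ r₁ hr₀ hr₁ hs₀ hs₁ N hN₀ hN₁ hNcl q hq
    hqinj y₀ hcov htrans]
  exact span_precomp_inf_eq_bot_iff_forall_sum_mul_eq_zero q hone hmul hcomm y₀ hcov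
    (fun y => ∑ x ∈ Finset.univ.filter (fun x => r₀ x = y), antiVec (Φ i₀) (1 : G) x)
    (fun y => ∑ x ∈ Finset.univ.filter (fun x => r₁ x = y), antiVec (Φ i₁) (1 : G) x)

/-- **Nondegeneracy form of the correlation criterion**: with all correlations zero, `Σ` is nondegenerate iff both
members are. [cite: Gordon1999HodgeAVSurvey, §3 Theorem (2) and 7.5–7.6.1] -/
theorem typeRank_sigmaType_eq_iff_forall_of_forall_sum_mul_precomp_eq_zero {ρ : G} {Φ : ∀ i, Set (E i)}
    (h : ∀ i, IsCMTypeWith ρ (Φ i)) {i₀ i₁ : I} (hI : ∀ j, j = i₀ ∨ j = i₁) (h01 : i₀ ≠ i₁)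
    (r₀ : E i₀ → Y) (r₁ : E i₁ → Y)
    (hr₀ : ∀ (g : G) (x : E i₀), r₀ (g • x) = g • r₀ x) (hr₁ : ∀ (g : G) (x : E i₁), r₁ (g • x) = g • r₁ x)
    (hs₀ : Function.Surjective r₀) (hs₁ : Function.Surjective r₁) (N : Set G)
    (hN₀ : ∀ x x' : E i₀, r₀ x = r₀ x' → ∃ n ∈ N, n • x = x')
    (hN₁ : ∀ x x' : E i₁, r₁ x = r₁ x' → ∃ n ∈ N, n • x = x')
    (hNcl : N ⊆ Subgroup.closure ({g : G | ∀ x : E i₀, g • x = x} ∪ {g : G | ∀ x : E i₁, g • x = x}))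
    (q : Γ → Y → Y) (hq : ∀ (σ : Γ) (g : G) (y : Y), q σ (g • y) = g • q σ y) (hone : ∀ y, q 1 y = y)
    (hmul : ∀ (σ τ : Γ) (y : Y), q (σ * τ) y = q τ (q σ y)) (hcomm : ∀ σ τ : Γ, σ * τ = τ * σ) (y₀ : Y)
    (hcov : ∀ y, ∃ σ, q σ y = y₀) (htrans : ∀ y : Y, ∃ g : G, g • y = y₀)
    (horth : ∀ σ : Γ, ∑ y, (∑ x ∈ Finset.univ.filter (fun x => r₀ x = y), antiVec (Φ i₀) (1 : G) x) *
      (∑ x ∈ Finset.univ.filter (fun x => r₁ x = q σ y), antiVec (Φ i₁) (1 : G) x) = 0) :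
    typeRank G (sigmaType Φ) = Fintype.card (Σ i, E i) / 2 + 1 ↔
      ∀ i, typeRank G (Φ i) = Fintype.card (E i) / 2 + 1 := by
  have hEq := (typeRank_sigmaType_add_card_eq_iff_forall_sum_mul_precomp_eq_zero h hI h01 r₀ r₁ hr₀ hr₁ hs₀ hs₁ N
    hN₀ hN₁ hNcl q hq hone hmul hcomm y₀ hcov htrans).2 horth
  exact typeRank_sigmaType_eq_iff_forall_of_forall_map_le h
    ((forall_map_slotExt_le_iff_typeRank_sigmaType_add_card_eq h).2 hEq)

end Criterion

end Summit.HodgeConjecture.CorCM.IrrOdd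

end
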